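import Literature.MathematicalPhysics.QuantumFieldTheory.Federbush1986.SimplyConnectedBox
import Mathlib.GroupTheory.SpecificGroups.Quaternion

/-!
# Federbush [F3] §5.3 2) «Observation» p. 303 — the LITERAL non-abelian reading FAILS: a kernel-checked witness
# (pairs of distinct tree-gauged `D₃`- and binary-dihedral-valued configurations on a box of `ℤ³` with identical plaquette variables)

statement-level skeleton of published theorems with citation tags; proofs where landed; nothing here is a claim about the
Yang–Mills mass gap

SOURCE. [Federbush1987PhaseCellIII] P. Federbush, *A phase cell approach to Yang–Mills theory III. Local stability, modified
renormalization group transformation*, Commun. Math. Phys. **110** (1987) 293–309, §5.3 step 2) p. 303, verbatim: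
*«Observation. In a simply connected lattice, if the bonds in a maximal tree are assigned the identity as a choice of gauge,
then the bond variables are uniquely determined by the plaquette variables.»* (plaquette variable `g_{∂p}` = the group element
(5.11) of the boundary contour `∂p` of Fig. 6, `LatticeContour.plaqLoop`; «simply connected» = print's sentence p. 303,
`LatticeContour.SimplyConnected`; «maximal tree … assigned the identity» = `LatticeContour.Spans` + `u = ε` on the tree.)

CITATION HEADER (lean-in-tree rule).  lit-balaban cell (HOME `run/shared/lean/pub/lit-balaban/`), Phase-2 proof seat p26
(gen 10), SKELETON row **F3.Eq5.26-5.40** (§5.3, head `absent`; owner r17, referee ref-5); companion to p32's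
`SimplyConnectedObservation` (p308526: the Observation PROVED in the flat form for every group, AS PRINTED for abelian groups,
and in the Lie-algebra/linearised form (5.22)–(5.23)) and to this seat's `SimplyConnectedBox` (p309738: every box of `ℤ^d` is
simply connected).  GAPS.md entry G-F3-p26-01 records the reading.

WHAT IS PROVED (everything by kernel computation, `decide +kernel`, axioms standard).  On the box `Λ = boxBonds 0 (3,3,2)`
of `ℤ³` (4·4·3 = 48 sites, 104 bonds, 75 plaquettes `P = boxPlaq 0 (3,3,2)`, a simply connected lattice by
`SimplyConnectedBox.simplyConnected_box`) there are
* a maximal tree `treeT ⊆ Λ` (47 = 48 − 1 bonds, `inTree_count`; it joins `0` to every site of the box: `spans : Spans treeT Λ 0`), and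
* two configurations `cfgU cfgU' : Bond 3 → D₃` (`D₃ = DihedralGroup 3 ≅ S₃`, the smallest non-abelian group), both `= 1` on
  `treeT` (`cfgU_treeGauge`, `cfgU'_treeGauge`), with THE SAME plaquette variable on EVERY plaquette of the box
  (`plaq_eq`: `∀ p ∈ P`, `wordHol cfgU (plaqLoop p…) = wordHol cfgU' (plaqLoop p…)`, both orientations of every plaquette), and nevertheless
  `cfgU ≠ cfgU'` on a bond of `Λ` (`cfgU_ne`; in fact on exactly 40 of the 104 bonds, all non-tree: `ne_count`).
Hence (`not_observation_literal`) the statement of p32's `eq_of_plaq_eq_of_treeGauge` with `[CommGroup G]` weakened to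
`[Group G]` — the literal sentence of the Observation, read for all configurations of a non-abelian group — is FALSE already
for `d = 3`, `G = D₃` and a rectangular box.  Moreover `cfgU` takes only the two values `1`, `sr 0` (`cfgU_values`: it is a
`ℤ₂`-valued configuration), while `cfgU'` is genuinely non-abelian (`cfgU'_noncomm`).
* The same for a second pair `cfgQ ≠ cfgQ'` with values in the binary dihedral group `QuaternionGroup 3` (dicyclic, order
  12 — a finite subgroup of [F3]'s gauge group `SU(2)`; §3b, `observation_witness_binaryDihedral`), and TRANSPORT along any
  injective homomorphism (`map_wordHol`, `observation_fails_of_injective`, `observation_fails_of_injective_binaryDihedral`):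
  the literal sentence fails in every group containing a copy of `S₃` or of the binary dihedral group of order 12 (so in
  `SO(3)`, `SU(2)`, `SU(N)`, `U(N)`, `N ≥ 2` — these embeddings are classical and not constructed here).

HOW IT WAS FOUND (kernel-external, scripts and data in HOME `lit-balaban-p26/obs/`).  In the tree gauge the configurations
are the homomorphisms `F → G` of the free group `F = π₁(1-skeleton)` on the non-tree bonds, and «determined by the plaquette
variables» for every `G` means that the based plaquette loops `r_p` (print's `∂p`, read from its corner through the tree)
GENERATE `F` — strictly stronger than simple connectivity (= the `r_p` normally generate `F`).  Stallings folding shows that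
for the comb tree ([F3]'s own gauge, p32's `CombBlock`), for the boustrophedon Hamiltonian path, and for all breadth-first /
Kruskal / uniformly random maximal trees we sampled, the `r_p` do generate `F` (so there the Observation holds for every
group: 0 failures in 300 samples of each kind, for this box and for the `4·4·4`-site block), but randomised depth-first
maximal trees (long winding paths) of boxes with at least `4·4·3` sites generate a proper subgroup `H` in a few percent of
the samples (7/300 for this box, 20/300 for the `4·4·4`-site block; here `H` is free of rank 72 while `F` has rank 57,
of infinite index); a based gauge transformation on the Stallings graph of `H` then produces the second configuration.
For the quaternion group `Q₈` no second configuration exists on the two such trees tried (exhaustive search); for the binary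
dihedral group of order 12 and the binary tetrahedral group `SL(2,3)` (finite subgroups of `SU(2)`) and for
`S₃ ⊂ SO(3) ⊂ SU(3)` it does.

HONEST SCOPE.  This does NOT contradict the use of the Observation in [F3]: print applies it in the small-field region, via
the power series (5.22) and «by the inverse function theorem … for `A_{∂p_i}` small enough» (5.23)–(5.24), i.e. as LOCAL
unique determination near the identity, whose linearisation is p32's `plaqMap_injective` (true for every simply connected
lattice and every spanning tree); and [F3]'s concrete gauge is the comb («Bałaban gauge», step 3)), for which determination
holds globally for every group (p32 `CombBlock.gbond_determined`).  The witness shows exactly that the sentence cannot be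
read globally for non-abelian groups and arbitrary maximal trees: `cfgU'` is far from the identity.  Nothing here models
steps 1)–3) (removed vertices, balls around large-field plaquettes).
-/

namespace Literature.MathematicalPhysics.QuantumFieldTheory.Federbush1986.ObservationNonabelianWitness

open LatticeContour SimplyConnectedBox DihedralGroup

/-! ## §1 The data: the box `[0,3]×[0,3]×[0,2] ⊂ ℤ³`, a maximal tree, two `D₃`-valued configurations -/

/-- The highest corner `(3,3,2)` of the box (lowest corner `0`): `4·4·3 = 48` sites. [cite: Federbush1987PhaseCellIII, §5.3 1) p. 303] -/
def hi : Site 3 := ![3, 3, 2]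

/-- The lattice `Λ`: the 104 unit bonds of the box. [cite: Federbush1987PhaseCellIII, §5.3 1)–2) p. 303] -/
abbrev boxΛ : Set (Bond 3) := boxBonds 0 hi

/-- The admissible plaquettes `P`: the 75 unit squares of the box (each with both orientations). [cite: Federbush1987PhaseCellIII, §5.3 2) p. 303] -/
abbrev boxP : Set (LatticeContour.Plaq 3) := boxPlaq 0 hi

/-- Table lookup `t[x₂][x₁][x₀][μ]` for a bond `(x, μ)` (default outside the table). [folklore] -/
def lk {α : Type} (t : List (List (List (List α)))) (dflt : α) (x : Site 3) (μ : Fin 3) : α :=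
  (((t.getD (x 2).toNat []).getD (x 1).toNat []).getD (x 0).toNat []).getD μ.val dflt

/-- The maximal tree (a depth-first spanning tree of the 48 sites; `true` at `[x₂][x₁][x₀][μ]` iff the bond `(x, μ)` belongs
to it; 47 entries `true`). [cite: Federbush1987PhaseCellIII, §5.3 2) p. 303 «maximal tree»] -/
def treeTab : List (List (List (List Bool))) :=
  [[[[true, true, false], [true, false, false], [false, true, false], [false, true, true]],
    [[false, true, false], [false, false, true], [false, true, false], [false, true, false]],
    [[true, false, false], [false, true, false], [false, false, true], [false, true, false]],
    [[false, false, true], [true, false, false], [true, false, false], [false, false, false]]],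
   [[[false, true, true], [true, false, true], [false, true, false], [false, false, true]],
    [[true, false, false], [false, true, false], [true, false, false], [false, true, false]],
    [[true, false, true], [false, false, false], [true, false, false], [false, false, false]],
    [[true, false, true], [true, false, false], [true, false, true], [false, false, false]]],
   [[[false, true, false], [true, false, false], [false, true, false], [false, true, false]],
    [[false, false, false], [false, true, false], [false, true, false], [false, true, false]],
    [[false, true, false], [true, false, false], [false, false, false], [false, true, false]],
    [[true, false, false], [false, false, false], [true, false, false], [false, false, false]]]]

/-- The first configuration (values at `[x₂][x₁][x₀][μ]`; `r 0 = 1` on tree bonds and non-bonds). [cite: Federbush1987PhaseCellIII, §5.1 p. 300] -/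
def uTab : List (List (List (List (DihedralGroup 3)))) :=
  [[[[r 0, r 0, r 0], [r 0, r 0, r 0], [r 0, r 0, r 0], [r 0, r 0, r 0]],
    [[r 0, r 0, r 0], [sr 0, sr 0, r 0], [r 0, r 0, r 0], [r 0, r 0, sr 0]],
    [[r 0, r 0, r 0], [sr 0, r 0, sr 0], [r 0, r 0, r 0], [r 0, r 0, sr 0]],
    [[sr 0, r 0, r 0], [r 0, r 0, r 0], [r 0, r 0, sr 0], [r 0, r 0, r 0]]],
   [[[sr 0, r 0, r 0], [r 0, sr 0, r 0], [r 0, r 0, r 0], [r 0, sr 0, r 0]],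
    [[r 0, r 0, r 0], [sr 0, r 0, sr 0], [r 0, r 0, r 0], [r 0, r 0, sr 0]],
    [[r 0, r 0, r 0], [r 0, sr 0, r 0], [r 0, sr 0, r 0], [r 0, r 0, r 0]],
    [[r 0, r 0, r 0], [r 0, r 0, r 0], [r 0, r 0, r 0], [r 0, r 0, r 0]]],
   [[[r 0, r 0, r 0], [r 0, r 0, r 0], [r 0, r 0, r 0], [r 0, r 0, r 0]],
    [[r 0, r 0, r 0], [r 0, r 0, r 0], [r 0, r 0, r 0], [r 0, r 0, r 0]],
    [[r 0, r 0, r 0], [r 0, sr 0, r 0], [r 0, r 0, r 0], [r 0, r 0, r 0]],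
    [[r 0, r 0, r 0], [r 0, r 0, r 0], [r 0, r 0, r 0], [r 0, r 0, r 0]]]]

/-- The second configuration. [cite: Federbush1987PhaseCellIII, §5.1 p. 300] -/
def u'Tab : List (List (List (List (DihedralGroup 3)))) :=
  [[[[r 0, r 0, r 2], [r 0, r 2, r 0], [r 2, r 0, r 0], [r 0, r 0, r 0]],
    [[r 2, r 0, r 2], [sr 2, sr 2, r 0], [r 2, r 0, r 0], [r 0, r 0, sr 2]],
    [[r 0, r 2, r 2], [sr 1, r 0, sr 2], [r 2, r 2, r 0], [r 0, r 0, sr 2]],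
    [[sr 2, r 0, r 0], [r 0, r 0, r 1], [r 0, r 0, sr 1], [r 0, r 0, r 1]]],
   [[[sr 2, r 0, r 0], [r 0, sr 2, r 0], [r 2, r 0, r 0], [r 0, sr 2, r 0]],
    [[r 0, r 0, r 0], [sr 2, r 0, sr 2], [r 0, r 0, r 0], [r 0, r 0, sr 2]],
    [[r 0, r 0, r 0], [r 2, sr 0, r 2], [r 0, sr 2, r 0], [r 0, r 2, r 2]],
    [[r 0, r 0, r 0], [r 0, r 0, r 0], [r 0, r 0, r 0], [r 0, r 0, r 0]]],
   [[[r 2, r 0, r 0], [r 0, r 0, r 0], [r 2, r 0, r 0], [r 0, r 0, r 0]],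
    [[r 2, r 0, r 0], [r 0, r 0, r 0], [r 2, r 0, r 0], [r 0, r 0, r 0]],
    [[r 2, r 0, r 0], [r 0, sr 2, r 0], [r 2, r 2, r 0], [r 0, r 0, r 0]],
    [[r 0, r 0, r 0], [r 0, r 0, r 0], [r 0, r 0, r 0], [r 0, r 0, r 0]]]]

/-- A second pair, with values in the binary dihedral group `QuaternionGroup 3` (dicyclic of order 12 — a finite subgroup of
`SU(2)`, [F3]'s gauge group): first configuration (values at `[x₂][x₁][x₀][μ]`, `a 0 = 1` on tree bonds and non-bonds). [cite: Federbush1987PhaseCellIII, §5.1 p. 300] -/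
def qTab : List (List (List (List (QuaternionGroup 3)))) :=
  [[[[.a 0, .a 0, .a 0], [.a 0, .a 0, .a 0], [.a 0, .a 0, .a 0], [.a 0, .a 0, .a 0]],
    [[.a 0, .a 0, .a 0], [.xa 0, .xa 0, .a 0], [.a 0, .a 0, .a 0], [.a 0, .a 0, .xa 0]],
    [[.a 0, .a 0, .a 0], [.xa 0, .a 0, .xa 0], [.a 0, .a 0, .a 0], [.a 0, .a 0, .xa 0]],
    [[.xa 0, .a 0, .a 0], [.a 0, .a 0, .a 0], [.a 0, .a 0, .xa 0], [.a 0, .a 0, .a 0]]],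
   [[[.xa 0, .a 0, .a 0], [.a 0, .xa 0, .a 0], [.a 0, .a 0, .a 0], [.a 0, .xa 0, .a 0]],
    [[.a 0, .a 0, .a 0], [.xa 0, .a 0, .xa 0], [.a 0, .a 0, .a 0], [.a 0, .a 0, .xa 0]],
    [[.a 0, .a 0, .a 0], [.a 0, .xa 0, .a 0], [.a 0, .xa 0, .a 0], [.a 0, .a 0, .a 0]],
    [[.a 0, .a 0, .a 0], [.a 0, .a 0, .a 0], [.a 0, .a 0, .a 0], [.a 0, .a 0, .a 0]]],
   [[[.a 0, .a 0, .a 0], [.a 0, .a 0, .a 0], [.a 0, .a 0, .a 0], [.a 0, .a 0, .a 0]],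
    [[.a 0, .a 0, .a 0], [.a 0, .a 0, .a 0], [.a 0, .a 0, .a 0], [.a 0, .a 0, .a 0]],
    [[.a 0, .a 0, .a 0], [.a 0, .xa 0, .a 0], [.a 0, .a 0, .a 0], [.a 0, .a 0, .a 0]],
    [[.a 0, .a 0, .a 0], [.a 0, .a 0, .a 0], [.a 0, .a 0, .a 0], [.a 0, .a 0, .a 0]]]]

/-- … and the second `QuaternionGroup 3`-valued configuration. [cite: Federbush1987PhaseCellIII, §5.1 p. 300] -/
def q'Tab : List (List (List (List (QuaternionGroup 3)))) :=
  [[[[.a 0, .a 0, .a 4], [.a 0, .a 4, .a 0], [.a 4, .a 0, .a 0], [.a 0, .a 0, .a 0]],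
    [[.a 4, .a 0, .a 4], [.xa 4, .xa 4, .a 0], [.a 4, .a 0, .a 0], [.a 0, .a 0, .xa 4]],
    [[.a 0, .a 4, .a 4], [.xa 2, .a 0, .xa 4], [.a 4, .a 4, .a 0], [.a 0, .a 0, .xa 4]],
    [[.xa 4, .a 0, .a 0], [.a 0, .a 0, .a 2], [.a 0, .a 0, .xa 2], [.a 0, .a 0, .a 2]]],
   [[[.xa 4, .a 0, .a 0], [.a 0, .xa 4, .a 0], [.a 4, .a 0, .a 0], [.a 0, .xa 4, .a 0]],
    [[.a 0, .a 0, .a 0], [.xa 4, .a 0, .xa 4], [.a 0, .a 0, .a 0], [.a 0, .a 0, .xa 4]],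
    [[.a 0, .a 0, .a 0], [.a 4, .xa 0, .a 4], [.a 0, .xa 4, .a 0], [.a 0, .a 4, .a 4]],
    [[.a 0, .a 0, .a 0], [.a 0, .a 0, .a 0], [.a 0, .a 0, .a 0], [.a 0, .a 0, .a 0]]],
   [[[.a 4, .a 0, .a 0], [.a 0, .a 0, .a 0], [.a 4, .a 0, .a 0], [.a 0, .a 0, .a 0]],
    [[.a 4, .a 0, .a 0], [.a 0, .a 0, .a 0], [.a 4, .a 0, .a 0], [.a 0, .a 0, .a 0]],
    [[.a 4, .a 0, .a 0], [.a 0, .xa 4, .a 0], [.a 4, .a 4, .a 0], [.a 0, .a 0, .a 0]],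
    [[.a 0, .a 0, .a 0], [.a 0, .a 0, .a 0], [.a 0, .a 0, .a 0], [.a 0, .a 0, .a 0]]]]

/-- Tree indicator of a bond. [cite: Federbush1987PhaseCellIII, §5.3 2) p. 303] -/
def inTree (b : Bond 3) : Bool := lk treeTab false b.1 b.2

/-- The maximal tree `T ⊆ Λ` as a set of bonds. [cite: Federbush1987PhaseCellIII, §5.3 2) p. 303] -/
def treeT : Set (Bond 3) := {b | b ∈ boxΛ ∧ inTree b = true}

/-- The first bond configuration `u : Bond 3 → D₃`. [cite: Federbush1987PhaseCellIII, §5.1 p. 300] -/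
def cfgU (b : Bond 3) : DihedralGroup 3 := lk uTab 1 b.1 b.2

/-- The second bond configuration `u′ : Bond 3 → D₃`. [cite: Federbush1987PhaseCellIII, §5.1 p. 300] -/
def cfgU' (b : Bond 3) : DihedralGroup 3 := lk u'Tab 1 b.1 b.2

/-- The first `QuaternionGroup 3`-valued bond configuration. [cite: Federbush1987PhaseCellIII, §5.1 p. 300] -/
def cfgQ (b : Bond 3) : QuaternionGroup 3 := lk qTab 1 b.1 b.2

/-- The second `QuaternionGroup 3`-valued bond configuration. [cite: Federbush1987PhaseCellIII, §5.1 p. 300] -/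
def cfgQ' (b : Bond 3) : QuaternionGroup 3 := lk q'Tab 1 b.1 b.2

/-! ## §2 Decidability of the box predicates; the finite parametrisation of the box sites -/

/-- Membership in a box of sites is decidable. [folklore] -/
instance decMemBoxSites (lo hi x : Site 3) : Decidable (x ∈ boxSites lo hi) :=
  decidable_of_iff _ mem_boxSites.symm

/-- Membership in the bonds of a box is decidable. [folklore] -/
instance decMemBoxBonds (lo hi : Site 3) (b : Bond 3) : Decidable (b ∈ boxBonds lo hi) :=
  decidable_of_iff _ mem_boxBonds.symm

/-- Membership in the plaquettes of a box is decidable. [folklore] -/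
instance decMemBoxPlaq (lo hi : Site 3) (p : LatticeContour.Plaq 3) : Decidable (p ∈ boxPlaq lo hi) :=
  decidable_of_iff _ mem_boxPlaq.symm

/-- Unfolding membership in the tree. [cite: Federbush1987PhaseCellIII, §5.3 2) p. 303] -/
theorem mem_treeT {b : Bond 3} : b ∈ treeT ↔ b ∈ boxΛ ∧ inTree b = true := Iff.rfl

/-- Membership in the tree is decidable. [folklore] -/
instance decMemTreeT (b : Bond 3) : Decidable (b ∈ treeT) :=
  decidable_of_iff _ mem_treeT.symm

/-- The site `(a, b, c)`. [folklore] -/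
def toSite (a b : Fin 4) (c : Fin 3) : Site 3 := ![((a : ℕ) : ℤ), ((b : ℕ) : ℤ), ((c : ℕ) : ℤ)]

/-- Every site of the box is `(a, b, c)` with `a, b < 4`, `c < 3`. [cite: Federbush1987PhaseCellIII, §5.3 1) p. 303] -/
theorem exists_toSite {x : Site 3} (hx : x ∈ boxSites 0 hi) : ∃ (a b : Fin 4) (c : Fin 3), x = toSite a b c := by
  have h0 : 0 ≤ x 0 ∧ x 0 ≤ 3 := by simpa [hi] using (mem_boxSites.1 hx) 0
  have h1 : 0 ≤ x 1 ∧ x 1 ≤ 3 := by simpa [hi] using (mem_boxSites.1 hx) 1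
  have h2 : 0 ≤ x 2 ∧ x 2 ≤ 2 := by simpa [hi] using (mem_boxSites.1 hx) 2
  refine ⟨⟨(x 0).toNat, by omega⟩, ⟨(x 1).toNat, by omega⟩, ⟨(x 2).toNat, by omega⟩, ?_⟩
  funext i
  fin_cases i <;> simp [toSite] <;> omega

/-! ## §3 The checks: tree gauge, equal plaquette variables, distinct configurations (kernel computations) -/

/-- `T ⊆ Λ`. [cite: Federbush1987PhaseCellIII, §5.3 2) p. 303] -/
theorem treeT_subset : treeT ⊆ boxΛ := fun _ hb => hb.1

/-- «the bonds in a maximal tree are assigned the identity»: `u = ε` on `T`. [cite: Federbush1987PhaseCellIII, §5.3 2) p. 303] -/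
theorem cfgU_treeGauge : ∀ b ∈ treeT, cfgU b = 1 := by
  rintro ⟨x, μ⟩ ⟨hΛ, ht⟩
  obtain ⟨a, b, c, rfl⟩ := exists_toSite (mem_boxBonds.1 hΛ).1
  clear hΛ
  revert ht μ c b a
  decide +kernel

/-- `u′ = ε` on `T`. [cite: Federbush1987PhaseCellIII, §5.3 2) p. 303] -/
theorem cfgU'_treeGauge : ∀ b ∈ treeT, cfgU' b = 1 := by
  rintro ⟨x, μ⟩ ⟨hΛ, ht⟩
  obtain ⟨a, b, c, rfl⟩ := exists_toSite (mem_boxBonds.1 hΛ).1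
  clear hΛ
  revert ht μ c b a
  decide +kernel

/-- **Equal plaquette variables**: `g_{∂p}(u) = g_{∂p}(u′)` for every plaquette `p` of the box (both orientations), the
plaquette variable being the group element (5.11) of the contour `∂p` of Fig. 6. [cite: Federbush1987PhaseCellIII, (5.9)–(5.11) p. 300, §5.3 2) p. 303] -/
theorem plaq_eq : ∀ p ∈ boxP,
    wordHol cfgU (plaqLoop p.1 p.2.1 p.2.2) = wordHol cfgU' (plaqLoop p.1 p.2.1 p.2.2) := by
  rintro ⟨z, μ, ν⟩ hp
  obtain ⟨a, b, c, rfl⟩ := exists_toSite (mem_boxPlaq.1 hp).2.1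
  revert hp ν μ c b a
  decide +kernel

/-- The bond `⟨0, e₂⟩ = ((0,0,0), 2)` lies in `Λ`. [cite: Federbush1987PhaseCellIII, §5.3 1) p. 303] -/
theorem bond0_mem : ((toSite 0 0 0, (2 : Fin 3)) : Bond 3) ∈ boxΛ := by
  decide +kernel

/-- … and the two configurations DIFFER there (`u = 1`, `u′ = r 2`). [cite: Federbush1987PhaseCellIII, §5.3 2) p. 303] -/
theorem cfgU_ne : cfgU (toSite 0 0 0, (2 : Fin 3)) ≠ cfgU' (toSite 0 0 0, (2 : Fin 3)) := by
  decide +kernel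

/-- The tree has `47 = 48 − 1` bonds (count of the `true` entries at actual bonds of the box; being connected on the 48 sites
by `spans` below, it is therefore a spanning = maximal tree). [cite: Federbush1987PhaseCellIII, §5.3 2) p. 303] -/
theorem inTree_count :
    (Finset.univ.filter fun q : Fin 4 × Fin 4 × Fin 3 × Fin 3 =>
        (toSite q.1 q.2.1 q.2.2.1, q.2.2.2) ∈ boxΛ ∧ inTree (toSite q.1 q.2.1 q.2.2.1, q.2.2.2) = true).card = 47 := by
  decide +kernel

/-- No bond outside `Λ` is marked as a tree bond. [cite: Federbush1987PhaseCellIII, §5.3 2) p. 303] -/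
theorem inTree_only_box :
    ∀ q : Fin 4 × Fin 4 × Fin 3 × Fin 3, inTree (toSite q.1 q.2.1 q.2.2.1, q.2.2.2) = true →
      (toSite q.1 q.2.1 q.2.2.1, q.2.2.2) ∈ boxΛ := by
  decide +kernel

/-- The two configurations differ on exactly 40 of the 104 bonds of `Λ` (all of them non-tree bonds). [cite: Federbush1987PhaseCellIII, §5.3 2) p. 303] -/
theorem ne_count :
    (Finset.univ.filter fun q : Fin 4 × Fin 4 × Fin 3 × Fin 3 =>
        (toSite q.1 q.2.1 q.2.2.1, q.2.2.2) ∈ boxΛ ∧ cfgU (toSite q.1 q.2.1 q.2.2.1, q.2.2.2) ≠ cfgU' (toSite q.1 q.2.1 q.2.2.1, q.2.2.2)).card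
      = 40 ∧
    (Finset.univ.filter fun q : Fin 4 × Fin 4 × Fin 3 × Fin 3 => (toSite q.1 q.2.1 q.2.2.1, q.2.2.2) ∈ boxΛ).card = 104 := by
  constructor <;> decide +kernel

/-- The first configuration is `ℤ₂`-valued: only the values `1` and the reflection `sr 0` occur on `Λ`. [cite: Federbush1987PhaseCellIII, §5.1 p. 300] -/
theorem cfgU_values : ∀ b ∈ boxΛ, cfgU b = 1 ∨ cfgU b = sr 0 := by
  rintro ⟨x, μ⟩ hΛ
  obtain ⟨a, b, c, rfl⟩ := exists_toSite (mem_boxBonds.1 hΛ).1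
  clear hΛ
  revert μ c b a
  decide +kernel

/-- The second configuration is genuinely non-abelian: two of its bond variables do not commute. [cite: Federbush1987PhaseCellIII, §5.1 p. 300] -/
theorem cfgU'_noncomm : ∃ b ∈ boxΛ, ∃ b' ∈ boxΛ, cfgU' b * cfgU' b' ≠ cfgU' b' * cfgU' b := by
  exact ⟨(toSite 0 0 0, (2 : Fin 3)), by decide +kernel, (toSite 0 0 1, (0 : Fin 3)), by decide +kernel, by decide +kernel⟩

/-! ### §3b The same checks for the `QuaternionGroup 3`-valued pair (a finite subgroup of `SU(2)`) -/

/-- `u = ε` on `T` (binary dihedral pair). [cite: Federbush1987PhaseCellIII, §5.3 2) p. 303] -/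
theorem cfgQ_treeGauge : ∀ b ∈ treeT, cfgQ b = 1 := by
  rintro ⟨x, μ⟩ ⟨hΛ, ht⟩
  obtain ⟨a, b, c, rfl⟩ := exists_toSite (mem_boxBonds.1 hΛ).1
  clear hΛ
  revert ht μ c b a
  decide +kernel

/-- `u′ = ε` on `T` (binary dihedral pair). [cite: Federbush1987PhaseCellIII, §5.3 2) p. 303] -/
theorem cfgQ'_treeGauge : ∀ b ∈ treeT, cfgQ' b = 1 := by
  rintro ⟨x, μ⟩ ⟨hΛ, ht⟩
  obtain ⟨a, b, c, rfl⟩ := exists_toSite (mem_boxBonds.1 hΛ).1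
  clear hΛ
  revert ht μ c b a
  decide +kernel

/-- Equal plaquette variables for the binary dihedral pair, every plaquette of the box, both orientations.
[cite: Federbush1987PhaseCellIII, (5.9)–(5.11) p. 300, §5.3 2) p. 303] -/
theorem plaq_eq_Q : ∀ p ∈ boxP,
    wordHol cfgQ (plaqLoop p.1 p.2.1 p.2.2) = wordHol cfgQ' (plaqLoop p.1 p.2.1 p.2.2) := by
  rintro ⟨z, μ, ν⟩ hp
  obtain ⟨a, b, c, rfl⟩ := exists_toSite (mem_boxPlaq.1 hp).2.1
  revert hp ν μ c b a
  decide +kernel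

/-- The binary dihedral pair differs at `⟨0, e₂⟩` (`u = 1`, `u′ = a 4`). [cite: Federbush1987PhaseCellIII, §5.3 2) p. 303] -/
theorem cfgQ_ne : cfgQ (toSite 0 0 0, (2 : Fin 3)) ≠ cfgQ' (toSite 0 0 0, (2 : Fin 3)) := by
  decide +kernel

/-- The second binary dihedral configuration is genuinely non-abelian. [cite: Federbush1987PhaseCellIII, §5.1 p. 300] -/
theorem cfgQ'_noncomm : ∃ b ∈ boxΛ, ∃ b' ∈ boxΛ, cfgQ' b * cfgQ' b' ≠ cfgQ' b' * cfgQ' b := by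
  exact ⟨(toSite 0 0 0, (2 : Fin 3)), by decide +kernel, (toSite 0 0 1, (0 : Fin 3)), by decide +kernel, by decide +kernel⟩

/-! ## §4 The tree is maximal: it joins `0` to every site of the box (`Spans`) -/

/-- The contour obtained by walking from `x` along a list of moves `(μ, forward?)`. [cite: Federbush1987PhaseCellIII, §5.1 p. 300] -/
def walk : Site 3 → List (Fin 3 × Bool) → List (Letter 3)
  | _, [] => []
  | x, (μ, true) :: ms => ((x, μ), true) :: walk (x + ev μ) ms
  | x, (μ, false) :: ms => ((x - ev μ, μ), false) :: walk (x - ev μ) ms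

/-- The endpoint of such a walk. [cite: Federbush1987PhaseCellIII, §5.1 p. 300] -/
def endpt : Site 3 → List (Fin 3 × Bool) → Site 3
  | x, [] => x
  | x, (μ, true) :: ms => endpt (x + ev μ) ms
  | x, (μ, false) :: ms => endpt (x - ev μ) ms

/-- A walk is a contour from its start to its endpoint. [cite: Federbush1987PhaseCellIII, §5.1 p. 300] -/
theorem isPath_walk : ∀ (ms : List (Fin 3 × Bool)) (x : Site 3), IsPath x (endpt x ms) (walk x ms)
  | [], _ => rfl
  | (μ, true) :: ms, x => isPath_cons.2 ⟨rfl, isPath_walk ms (x + ev μ)⟩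
  | (μ, false) :: ms, x => isPath_cons.2 ⟨sub_add_cancel x (ev μ), isPath_walk ms (x - ev μ)⟩

/-- The tree paths: for the site `[x₂][x₁][x₀]`, the list of moves leading from `0` to it inside the tree (depth ≤ 27).
[cite: Federbush1987PhaseCellIII, §5.3 2) p. 303] -/
def pathTab : List (List (List (List (Fin 3 × Bool)))) :=
  [[[[],
      [(0, true)],
      [(0, true), (0, true)],
      [(1, true), (1, true), (0, true), (1, true), (0, true), (0, true), (1, false), (1, false), (1, false)]],
     [[(1, true)],
      [(1, true), (1, true), (0, true), (1, true), (0, true), (0, true), (1, false), (1, false), (1, false),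
        (2, true), (2, true), (1, true), (1, true), (1, true), (0, false), (2, false), (0, false), (0, false),
        (2, true), (1, false), (2, false), (0, true), (1, false), (2, false)],
      [(0, true), (0, true), (1, true)],
      [(1, true), (1, true), (0, true), (1, true), (0, true), (0, true), (1, false), (1, false)]],
     [[(1, true), (1, true)],
      [(1, true), (1, true), (0, true)],
      [(0, true), (0, true), (1, true), (1, true)],
      [(1, true), (1, true), (0, true), (1, true), (0, true), (0, true), (1, false)]],
     [[(1, true), (1, true), (0, true), (1, true), (0, true), (0, true), (1, false), (1, false), (1, false),
        (2, true), (2, true), (1, true), (1, true), (1, true), (0, false), (2, false), (0, false), (0, false),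
        (2, false)],
      [(1, true), (1, true), (0, true), (1, true)],
      [(1, true), (1, true), (0, true), (1, true), (0, true)],
      [(1, true), (1, true), (0, true), (1, true), (0, true), (0, true)]]],
   [[[(1, true), (1, true), (0, true), (1, true), (0, true), (0, true), (1, false), (1, false), (1, false),
        (2, true), (2, true), (1, true), (1, true), (1, true), (0, false), (2, false), (0, false), (0, false),
        (2, true), (1, false), (2, false), (0, true), (1, false), (0, false), (1, false)],
      [(0, true), (0, true), (1, true), (1, true), (2, true), (0, true), (1, false), (0, false), (1, false),
        (0, false)],
      [(0, true), (0, true), (1, true), (1, true), (2, true), (0, true), (1, false), (0, false), (1, false)],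
      [(1, true), (1, true), (0, true), (1, true), (0, true), (0, true), (1, false), (1, false), (1, false), (2, true)]],
     [[(1, true), (1, true), (0, true), (1, true), (0, true), (0, true), (1, false), (1, false), (1, false),
        (2, true), (2, true), (1, true), (1, true), (1, true), (0, false), (2, false), (0, false), (0, false),
        (2, true), (1, false), (2, false), (0, true), (1, false), (0, false)],
      [(1, true), (1, true), (0, true), (1, true), (0, true), (0, true), (1, false), (1, false), (1, false),
        (2, true), (2, true), (1, true), (1, true), (1, true), (0, false), (2, false), (0, false), (0, false),
        (2, true), (1, false), (2, false), (0, true), (1, false)],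
      [(0, true), (0, true), (1, true), (1, true), (2, true), (0, true), (1, false), (0, false)],
      [(0, true), (0, true), (1, true), (1, true), (2, true), (0, true), (1, false)]],
     [[(1, true), (1, true), (0, true), (1, true), (0, true), (0, true), (1, false), (1, false), (1, false),
        (2, true), (2, true), (1, true), (1, true), (1, true), (0, false), (2, false), (0, false), (0, false),
        (2, true), (1, false), (2, false)],
      [(1, true), (1, true), (0, true), (1, true), (0, true), (0, true), (1, false), (1, false), (1, false),
        (2, true), (2, true), (1, true), (1, true), (1, true), (0, false), (2, false), (0, false), (0, false),
        (2, true), (1, false), (2, false), (0, true)],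
      [(0, true), (0, true), (1, true), (1, true), (2, true)],
      [(0, true), (0, true), (1, true), (1, true), (2, true), (0, true)]],
     [[(1, true), (1, true), (0, true), (1, true), (0, true), (0, true), (1, false), (1, false), (1, false),
        (2, true), (2, true), (1, true), (1, true), (1, true), (0, false), (2, false), (0, false), (0, false)],
      [(1, true), (1, true), (0, true), (1, true), (0, true), (0, true), (1, false), (1, false), (1, false),
        (2, true), (2, true), (1, true), (1, true), (1, true), (0, false), (2, false), (0, false)],
      [(1, true), (1, true), (0, true), (1, true), (0, true), (0, true), (1, false), (1, false), (1, false),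
        (2, true), (2, true), (1, true), (1, true), (1, true), (0, false), (2, false)],
      [(1, true), (1, true), (0, true), (1, true), (0, true), (0, true), (1, false), (1, false), (1, false),
        (2, true), (2, true), (1, true), (1, true), (1, true), (0, false), (2, false), (0, true)]]],
   [[[(1, true), (1, true), (0, true), (1, true), (0, true), (0, true), (1, false), (1, false), (1, false),
        (2, true), (2, true), (1, true), (1, true), (1, true), (0, false), (2, false), (0, false), (0, false),
        (2, true), (1, false), (2, false), (0, true), (1, false), (0, false), (1, false), (2, true)],
      [(0, true), (0, true), (1, true), (1, true), (2, true), (0, true), (1, false), (0, false), (1, false),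
        (0, false), (2, true)],
      [(0, true), (0, true), (1, true), (1, true), (2, true), (0, true), (1, false), (0, false), (1, false),
        (0, false), (2, true), (0, true)],
      [(1, true), (1, true), (0, true), (1, true), (0, true), (0, true), (1, false), (1, false), (1, false),
        (2, true), (2, true)]],
     [[(1, true), (1, true), (0, true), (1, true), (0, true), (0, true), (1, false), (1, false), (1, false),
        (2, true), (2, true), (1, true), (1, true), (1, true), (0, false), (2, false), (0, false), (0, false),
        (2, true), (1, false), (2, false), (0, true), (1, false), (0, false), (1, false), (2, true), (1, true)],
      [(0, true), (0, true), (1, true), (1, true), (2, true), (0, true), (1, false), (0, false), (1, false),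
        (0, false), (2, true), (0, true), (1, true), (1, true), (0, false), (1, false)],
      [(0, true), (0, true), (1, true), (1, true), (2, true), (0, true), (1, false), (0, false), (1, false),
        (0, false), (2, true), (0, true), (1, true)],
      [(1, true), (1, true), (0, true), (1, true), (0, true), (0, true), (1, false), (1, false), (1, false),
        (2, true), (2, true), (1, true)]],
     [[(1, true), (1, true), (0, true), (1, true), (0, true), (0, true), (1, false), (1, false), (1, false),
        (2, true), (2, true), (1, true), (1, true), (1, true), (0, false), (2, false), (0, false), (0, false),
        (2, true), (1, false)],
      [(0, true), (0, true), (1, true), (1, true), (2, true), (0, true), (1, false), (0, false), (1, false),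
        (0, false), (2, true), (0, true), (1, true), (1, true), (0, false)],
      [(0, true), (0, true), (1, true), (1, true), (2, true), (0, true), (1, false), (0, false), (1, false),
        (0, false), (2, true), (0, true), (1, true), (1, true)],
      [(1, true), (1, true), (0, true), (1, true), (0, true), (0, true), (1, false), (1, false), (1, false),
        (2, true), (2, true), (1, true), (1, true)]],
     [[(1, true), (1, true), (0, true), (1, true), (0, true), (0, true), (1, false), (1, false), (1, false),
        (2, true), (2, true), (1, true), (1, true), (1, true), (0, false), (2, false), (0, false), (0, false),
        (2, true)],
      [(1, true), (1, true), (0, true), (1, true), (0, true), (0, true), (1, false), (1, false), (1, false),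
        (2, true), (2, true), (1, true), (1, true), (1, true), (0, false), (2, false), (0, false), (0, false),
        (2, true), (0, true)],
      [(1, true), (1, true), (0, true), (1, true), (0, true), (0, true), (1, false), (1, false), (1, false),
        (2, true), (2, true), (1, true), (1, true), (1, true), (0, false)],
      [(1, true), (1, true), (0, true), (1, true), (0, true), (0, true), (1, false), (1, false), (1, false),
        (2, true), (2, true), (1, true), (1, true), (1, true)]]]]

/-- The moves from `0` to the site `x`. [cite: Federbush1987PhaseCellIII, §5.3 2) p. 303] -/
def movesTo (x : Site 3) : List (Fin 3 × Bool) :=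
  ((pathTab.getD (x 2).toNat []).getD (x 1).toNat []).getD (x 0).toNat []

/-- Each tabulated walk ends at its site. [cite: Federbush1987PhaseCellIII, §5.3 2) p. 303] -/
theorem endpt_movesTo : ∀ (a b : Fin 4) (c : Fin 3), endpt 0 (movesTo (toSite a b c)) = toSite a b c := by
  decide +kernel

/-- Each tabulated walk stays inside the tree. [cite: Federbush1987PhaseCellIII, §5.3 2) p. 303] -/
theorem walk_subset_treeT : ∀ (a b : Fin 4) (c : Fin 3), ∀ l ∈ walk 0 (movesTo (toSite a b c)), l.1 ∈ treeT := by
  decide +kernel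

/-- The initial point of an oriented bond of `Λ` is a site of the box. [cite: Federbush1987PhaseCellIII, §5.1 p. 300] -/
theorem src_mem_boxSites {l : Letter 3} (hl : l.1 ∈ boxΛ) : src l ∈ boxSites 0 hi := by
  obtain ⟨b, _ | _⟩ := l
  · exact (mem_boxBonds.1 hl).2
  · exact (mem_boxBonds.1 hl).1

/-- **The tree is maximal**: it joins `0` to every endpoint of every bond of `Λ` («maximal tree»). [cite: Federbush1987PhaseCellIII, §5.3 2) p. 303] -/
theorem spans : Spans treeT boxΛ 0 := by
  intro l hl
  obtain ⟨a, b, c, hq⟩ := exists_toSite (src_mem_boxSites hl)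
  refine ⟨walk 0 (movesTo (toSite a b c)), ?_, walk_subset_treeT a b c⟩
  rw [hq]
  have h := isPath_walk (movesTo (toSite a b c)) 0
  rwa [endpt_movesTo] at h

/-! ## §5 The witness against the literal non-abelian reading -/

/-- **The witness.** On the simply connected lattice `Λ = boxBonds 0 (3,3,2)` with plaquettes `P = boxPlaq 0 (3,3,2)` and the
maximal tree `treeT` (identity gauge on it), the two `D₃`-configurations `cfgU ≠ cfgU'` have the same plaquette variables:
«the bond variables are uniquely determined by the plaquette variables» FAILS when read for all configurations of a
non-abelian group. [cite: Federbush1987PhaseCellIII, §5.3 2) Observation p. 303] -/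
theorem observation_witness :
    SimplyConnected boxP boxΛ ∧ treeT ⊆ boxΛ ∧ Spans treeT boxΛ 0 ∧
      (∀ b ∈ treeT, cfgU b = 1) ∧ (∀ b ∈ treeT, cfgU' b = 1) ∧
      (∀ p ∈ boxP, wordHol cfgU (plaqLoop p.1 p.2.1 p.2.2) = wordHol cfgU' (plaqLoop p.1 p.2.1 p.2.2)) ∧
      ∃ b ∈ boxΛ, cfgU b ≠ cfgU' b :=
  ⟨simplyConnected_box 0 hi, treeT_subset, spans, cfgU_treeGauge, cfgU'_treeGauge, plaq_eq, _, bond0_mem, cfgU_ne⟩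

/-- **The literal non-abelian Observation is false.** The statement of `SimplyConnectedObservation`'s
`eq_of_plaq_eq_of_treeGauge` (proved there for abelian `G`) with `[CommGroup G]` replaced by `[Group G]` fails in `d = 3`:
NOT every simply connected lattice with a maximal tree gauge has its bond variables determined by its plaquette variables
for every group.  (Print uses the Observation only near the identity, see the module docstring.) [cite: Federbush1987PhaseCellIII, §5.3 2) Observation p. 303] -/
theorem not_observation_literal :
    ¬ ∀ (G : Type) [Group G] (P : Set (LatticeContour.Plaq 3)) (Λ T : Set (Bond 3)) (x₀ : Site 3),
        SimplyConnected P Λ → T ⊆ Λ → Spans T Λ x₀ → ∀ u u' : Bond 3 → G,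
          (∀ b ∈ T, u b = 1) → (∀ b ∈ T, u' b = 1) →
          (∀ p ∈ P, wordHol u (plaqLoop p.1 p.2.1 p.2.2) = wordHol u' (plaqLoop p.1 p.2.1 p.2.2)) →
          ∀ b ∈ Λ, u b = u' b := by
  intro h
  exact cfgU_ne (h (DihedralGroup 3) boxP boxΛ treeT 0 (simplyConnected_box 0 hi) treeT_subset spans cfgU cfgU'
    cfgU_treeGauge cfgU'_treeGauge plaq_eq _ bond0_mem)

/-- A group homomorphism maps contour variables to contour variables. [cite: Federbush1987PhaseCellIII, (5.11) p. 300] -/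
theorem map_wordHol {G K : Type*} [Group G] [Group K] (f : G →* K) (u : Bond 3 → G) (w : List (Letter 3)) :
    f (wordHol u w) = wordHol (f ∘ u) w := by
  induction w with
  | nil => simp
  | cons l w ih =>
    rw [wordHol_cons', wordHol_cons', map_mul, ih]
    obtain ⟨b, _ | _⟩ := l <;> simp

/-- **Transport.** The failure persists in every group containing a copy of `D₃ ≅ S₃` (e.g. `SO(3)`, `SU(3)`, `U(N)`, `N ≥ 2`):
push the witness through an injective homomorphism. [cite: Federbush1987PhaseCellIII, §5.3 2) Observation p. 303] -/
theorem observation_fails_of_injective {K : Type*} [Group K] (ι : DihedralGroup 3 →* K) (hι : Function.Injective ι) :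
    ∃ u u' : Bond 3 → K, (∀ b ∈ treeT, u b = 1) ∧ (∀ b ∈ treeT, u' b = 1) ∧
      (∀ p ∈ boxP, wordHol u (plaqLoop p.1 p.2.1 p.2.2) = wordHol u' (plaqLoop p.1 p.2.1 p.2.2)) ∧
      ∃ b ∈ boxΛ, u b ≠ u' b := by
  refine ⟨ι ∘ cfgU, ι ∘ cfgU', fun b hb => ?_, fun b hb => ?_, fun p hp => ?_, _, bond0_mem, fun h => cfgU_ne (hι ?_)⟩
  · simp [cfgU_treeGauge b hb]
  · simp [cfgU'_treeGauge b hb]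
  · rw [← map_wordHol, ← map_wordHol, plaq_eq p hp]
  · simpa using h

/-- **The witness inside a finite subgroup of `SU(2)`.** The same lattice and maximal tree carry two tree-gauged configurations
with values in the binary dihedral group `QuaternionGroup 3` (order 12; realised in `SU(2)` by `a ↦ diag(e^{iπ/3}, e^{−iπ/3})`,
`x ↦ [[0,1],[−1,0]]` — this embedding is not constructed here) with identical plaquette variables and `u ≠ u′`; by transport
the literal Observation fails in every group containing a copy of it. [cite: Federbush1987PhaseCellIII, §5.3 2) Observation p. 303] -/
theorem observation_witness_binaryDihedral :
    SimplyConnected boxP boxΛ ∧ treeT ⊆ boxΛ ∧ Spans treeT boxΛ 0 ∧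
      (∀ b ∈ treeT, cfgQ b = 1) ∧ (∀ b ∈ treeT, cfgQ' b = 1) ∧
      (∀ p ∈ boxP, wordHol cfgQ (plaqLoop p.1 p.2.1 p.2.2) = wordHol cfgQ' (plaqLoop p.1 p.2.1 p.2.2)) ∧
      ∃ b ∈ boxΛ, cfgQ b ≠ cfgQ' b :=
  ⟨simplyConnected_box 0 hi, treeT_subset, spans, cfgQ_treeGauge, cfgQ'_treeGauge, plaq_eq_Q, _, bond0_mem, cfgQ_ne⟩

/-- Transport of the binary dihedral witness along an injective homomorphism (e.g. into `SU(2)`).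
[cite: Federbush1987PhaseCellIII, §5.3 2) Observation p. 303] -/
theorem observation_fails_of_injective_binaryDihedral {K : Type*} [Group K] (ι : QuaternionGroup 3 →* K)
    (hι : Function.Injective ι) :
    ∃ u u' : Bond 3 → K, (∀ b ∈ treeT, u b = 1) ∧ (∀ b ∈ treeT, u' b = 1) ∧
      (∀ p ∈ boxP, wordHol u (plaqLoop p.1 p.2.1 p.2.2) = wordHol u' (plaqLoop p.1 p.2.1 p.2.2)) ∧
      ∃ b ∈ boxΛ, u b ≠ u' b := by
  refine ⟨ι ∘ cfgQ, ι ∘ cfgQ', fun b hb => ?_, fun b hb => ?_, fun p hp => ?_, _, bond0_mem, fun h => cfgQ_ne (hι ?_)⟩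
  · simp [cfgQ_treeGauge b hb]
  · simp [cfgQ'_treeGauge b hb]
  · rw [← map_wordHol, ← map_wordHol, plaq_eq_Q p hp]
  · simpa using h

end Literature.MathematicalPhysics.QuantumFieldTheory.Federbush1986.ObservationNonabelianWitness
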